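import Summits.Ventures.YMGap.RobustBall.StateDerivativeOnBallS
import Summits.Ventures.YMGap.RobustBall.LoopActionMember
import HarnessLib

/-!
# Venture YMGap, track ROBUST-BALL (Y2) — TIER 2: LOOP-COUPLING DIRECTIONS — the state of every member of the weighted ball is `C¹` along
# every family of Wilson-loop couplings of finite loop-action norm, derivative = the loop susceptibility series

HONEST FRAMING. WHAT THIS IS: a venture file (cell `pub-ymgap`, track Y2 ROBUST-BALL, seat rb-p1, theorems only): the LOOP-BALL instance of
`StateDerivativeOnBallS`.  A direction is a generic Wilson-type loop action `loopFamilyAction N γ c = Σ_i c_i Re tr U_{γ_i}/N` (any family of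
closed lattice loops with finite carrier fibres) of finite loop-action norm `‖c‖_t ≤ ε` (`LoopNormLE t γ c ε`: through every link
`Σ_{i : e ∈ γ_i} |c_i| Σ_{y ∈ γ_i} mult_i(y) e^{t‖e−y‖} ≤ ε`).
* `isLipBound_loopFamilyAction`, `lipLoad_loopFamilyAction` — Frobenius-Lipschitz witnesses (fibre sums of `|c_i| mult_i(y)/√N`) with total
  load `≤ ε/√N` through every link;
* ★ `hasDerivAt_integral_loopDirection_S` — `W ∈ MemBallZdS a Λ t`, pair door at `(a + 2s₀ε, Λ + s₀ε, t)`: for EVERY selection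
  `ν(s) ∈ 𝒢(W + s·loopFamilyAction N γ c)` on `|s| ≤ s₀` and every bounded local Lipschitz `F`:
  `d/ds ∫ F dν(s) = −Σ'_X cov_{ν(s)}(F, (loopFamilyAction N γ c)_X)` at every `|s| < s₀`, and `ContDiffOn ℝ 1` — THE RESPONSE OF THE STATE TO ANY
  SUMMABLE DISTRIBUTION OF WILSON-LOOP SOURCES (all sizes, all shapes, infinitely many) IS LINEAR TO FIRST ORDER with the loop susceptibility series;
* `su2_hasDerivAt_integral_loopDirection_dim4` — `SU(2)`, `ℤ⁴`, hypothesis-free; `su2_wilson_hasDerivAt_integral_loopDirection` — at the Wilson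
  point: `6|β_W| e^{2s₀ε} e^{t} + e^{s₀ε} √(2/3) s₀ε < 1`.
WHAT THIS IS NOT: `C¹` along lines, one-sided comparison constants, lattice strong coupling; nothing about the continuum limit or a Clay-sense
mass gap.
-/

noncomputable section

open MeasureTheory Function Finset ProbabilityTheory Real Filter Topology
open scoped NNReal
open Literature.Probability.LatticeModels
open Literature.Probability.LatticeModels.DobrushinMetric
open Literature.MathematicalPhysics.QuantumLattice
open Literature.MathematicalPhysics.QuantumFieldTheory hiding ZdEdge
open Summit.QuantumFields.BalabanUV.InfraRed.StrongCouplingPoincareDoorSUN (oneLinkPoincareSUN_two_sharp)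

namespace Summit.Ventures.YMGap.RobustBall

variable {d N : ℕ} {ι : Type*} {γ : ι → ZdLoop d} {c : ι → ℝ} {w ε : ℝ}

/-! ### Lipschitz witnesses and the total Lipschitz load of a loop family -/

/-- Frobenius-Lipschitz witnesses of the loop-family action: fibre sums of `|c_i| mult_i(y)/√N`. -/
theorem isLipBound_loopFamilyAction (X : Finset (ZdEdge d)) :
    IsLipBound suFrobDist (loopFamilyAction (d := d) N γ c X)
      fun y => ∑ i ∈ carrierFib (fun i => walkEdges (γ i).walk) X, |c i| * (dartMult (γ i).walk y / Real.sqrt N) :=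
  isLipBound_indexedPotential (fib := carrierFib fun i => walkEdges (γ i).walk) (φ := fun i => loopTerm N (c i) (γ i).walk)
    (fun i => isLipBound_loopTerm (γ i).walk) X

/-- On a link of `γ_i`, the unweighted modulus `|c_i| Σ_y mult_i(y)` is dominated by the weight at any rate `w ≥ 0`. -/
theorem abs_coupling_mul_sum_dartMult_le_loopWeightAt (hw : 0 ≤ w) {e : ZdEdge d} {i : ι} (he : e ∈ walkEdges (γ i).walk) :
    |c i| * ∑ y ∈ walkEdges (γ i).walk, (dartMult (γ i).walk y : ℝ) ≤ loopWeightAt w γ c e i := by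
  unfold loopWeightAt
  rw [if_pos he]
  refine mul_le_mul_of_nonneg_left (Finset.sum_le_sum fun y _ => ?_) (abs_nonneg _)
  exact le_mul_of_one_le_right (Nat.cast_nonneg _) (one_le_exp (by positivity))

/-- **Per-loop Lipschitz loads**: `Σ'_{i : e ∈ γ_i} |c_i| (Σ_{y ∈ γ_i} mult_i(y))/√N ≤ ε/√N` through every link (weight `w ≥ 0`). -/
theorem perLoop_lipLoad (h : LoopNormLE w γ c ε) (hw : 0 ≤ w) (e : ZdEdge d) :
    (Summable fun i : ι => (if e ∈ walkEdges (γ i).walk then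
        ∑ y ∈ walkEdges (γ i).walk, |c i| * (dartMult (γ i).walk y / Real.sqrt N) else 0)) ∧
      ∑' i : ι, (if e ∈ walkEdges (γ i).walk then
        ∑ y ∈ walkEdges (γ i).walk, |c i| * (dartMult (γ i).walk y / Real.sqrt N) else 0) ≤ ε / Real.sqrt N := by
  have hsq0 : 0 ≤ (Real.sqrt N)⁻¹ := inv_nonneg.2 (Real.sqrt_nonneg _)
  have hgs := summable_of_le_loopWeightAt h e
    (g := fun i => if e ∈ walkEdges (γ i).walk then |c i| * ∑ y ∈ walkEdges (γ i).walk, (dartMult (γ i).walk y : ℝ) else 0)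
    (fun i => by split_ifs; exacts [mul_nonneg (abs_nonneg _) (Finset.sum_nonneg fun y _ => Nat.cast_nonneg _), le_rfl])
    fun i => by
      by_cases he : e ∈ walkEdges (γ i).walk
      · rw [if_pos he]; exact abs_coupling_mul_sum_dartMult_le_loopWeightAt hw he
      · rw [if_neg he]; exact loopWeightAt_nonneg w γ c e i
  have heq : (fun i : ι => (if e ∈ walkEdges (γ i).walk then
      ∑ y ∈ walkEdges (γ i).walk, |c i| * (dartMult (γ i).walk y / Real.sqrt N) else 0)) =
      fun i => (if e ∈ walkEdges (γ i).walk then |c i| * ∑ y ∈ walkEdges (γ i).walk, (dartMult (γ i).walk y : ℝ) else 0) *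
        (Real.sqrt N)⁻¹ := by
    funext i
    split_ifs
    · rw [Finset.mul_sum, Finset.sum_mul]
      exact Finset.sum_congr rfl fun y _ => by rw [div_eq_mul_inv]; ring
    · rw [zero_mul]
  rw [heq]
  refine ⟨hgs.1.mul_right _, ?_⟩
  rw [tsum_mul_right, div_eq_mul_inv]
  exact mul_le_mul_of_nonneg_right hgs.2 hsq0

/-- **The total Lipschitz load of a loop family of norm `≤ ε` is `≤ ε/√N` through every link** (finite carrier fibres, weight `w ≥ 0`). -/
theorem lipLoad_loopFamilyAction (hfin : ∀ X, {i | walkEdges (γ i).walk = X}.Finite) (h : LoopNormLE w γ c ε) (hw : 0 ≤ w)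
    (e : ZdEdge d) :
    (Summable fun X : Finset (ZdEdge d) => (if e ∈ X then ∑ y ∈ X,
        ∑ i ∈ carrierFib (fun i => walkEdges (γ i).walk) X, |c i| * (dartMult (γ i).walk y / Real.sqrt N) else 0)) ∧
      ∑' X : Finset (ZdEdge d), (if e ∈ X then ∑ y ∈ X,
        ∑ i ∈ carrierFib (fun i => walkEdges (γ i).walk) X, |c i| * (dartMult (γ i).walk y / Real.sqrt N) else 0) ≤
        ε / Real.sqrt N := by
  classical
  have hfib := mem_carrierFib hfin
  have hsq0 : 0 ≤ (Real.sqrt N)⁻¹ := inv_nonneg.2 (Real.sqrt_nonneg _)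
  -- the per-term load `g i := 𝟙[e ∈ γ_i] |c_i| Σ_{y ∈ γ_i} mult_i(y) / √N ≤ loopWeightAt / √N`
  set g : ι → ℝ := fun i => if e ∈ walkEdges (γ i).walk then
      |c i| * (∑ y ∈ walkEdges (γ i).walk, (dartMult (γ i).walk y : ℝ)) * (Real.sqrt N)⁻¹ else 0 with hg
  have hg0 : ∀ i, 0 ≤ g i := fun i => by
    simp only [hg]; split_ifs
    · exact mul_nonneg (mul_nonneg (abs_nonneg _) (Finset.sum_nonneg fun y _ => Nat.cast_nonneg _)) hsq0
    · exact le_rfl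
  have hgs := summable_of_le_loopWeightAt h e
    (g := fun i => if e ∈ walkEdges (γ i).walk then |c i| * ∑ y ∈ walkEdges (γ i).walk, (dartMult (γ i).walk y : ℝ) else 0)
    (fun i => by split_ifs; exacts [mul_nonneg (abs_nonneg _) (Finset.sum_nonneg fun y _ => Nat.cast_nonneg _), le_rfl])
    fun i => by
      by_cases he : e ∈ walkEdges (γ i).walk
      · rw [if_pos he]; exact abs_coupling_mul_sum_dartMult_le_loopWeightAt hw he
      · rw [if_neg he]; exact loopWeightAt_nonneg w γ c e i
  have hgsum : Summable g ∧ ∑' i, g i ≤ ε / Real.sqrt N := by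
    have heq : g = fun i => (if e ∈ walkEdges (γ i).walk then
        |c i| * ∑ y ∈ walkEdges (γ i).walk, (dartMult (γ i).walk y : ℝ) else 0) * (Real.sqrt N)⁻¹ := by
      funext i; simp only [hg]; split_ifs <;> simp
    rw [heq]
    refine ⟨hgs.1.mul_right _, ?_⟩
    rw [tsum_mul_right, div_eq_mul_inv]
    exact mul_le_mul_of_nonneg_right hgs.2 hsq0
  -- the link-set family is the fibre sum of `g`
  have hX : ∀ X : Finset (ZdEdge d), (if e ∈ X then ∑ y ∈ X,
      ∑ i ∈ carrierFib (fun i => walkEdges (γ i).walk) X, |c i| * (dartMult (γ i).walk y / Real.sqrt N) else 0) =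
      ∑ i ∈ carrierFib (fun i => walkEdges (γ i).walk) X, g i := by
    intro X
    by_cases heX : e ∈ X
    · rw [if_pos heX, Finset.sum_comm]
      refine Finset.sum_congr rfl fun i hi => ?_
      have hci : walkEdges (γ i).walk = X := (hfib X i).1 hi
      simp only [hg, hci, if_pos heX, Finset.mul_sum, Finset.sum_mul]
      exact Finset.sum_congr rfl fun y _ => by rw [div_eq_mul_inv]; ring
    · rw [if_neg heX]
      exact (Finset.sum_eq_zero fun i hi => by simp only [hg, (hfib X i).1 hi, if_neg heX]).symm
  simp only [hX]
  exact ⟨summable_sum_fib hfib hg0 hgsum.1, (tsum_sum_fib_le hfib hg0 hgsum.1).trans hgsum.2⟩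

/-! ### The derivative along a loop-coupling direction -/

section Derivative

variable {W : Potential (ZdEdge d) (Matrix.specialUnitaryGroup (Fin N) ℂ)}

/-- ★ **THE STATE OF EVERY MEMBER OF THE WEIGHTED BALL IS `C¹` ALONG EVERY LOOP-COUPLING DIRECTION OF FINITE LOOP-ACTION NORM.**  Member
`W ∈ MemBallZdS a Λ t` (`t > 0`), loop family `(γ, c)` with finite carrier fibres and `‖c‖_t ≤ ε` (`LoopNormLE t γ c ε`), `s₀ > 0`, pair door
`ρ' < 1` at `(a', Λ', t)` with `a + s₀·2ε ≤ a'`, `Λ + s₀·ε ≤ Λ'`; `ν(s) ∈ 𝒢(W + s·loopFamilyAction N γ c)` ANY selection on `|s| ≤ s₀`; `F` bounded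
measurable local with Frobenius-Lipschitz vector `δ_F`.  Then (i) `HasDerivAt (s ↦ ∫ F dν(s)) (−Σ'_X cov_{ν(s)}(F, (loopFamilyAction N γ c)_X)) s` at
every `|s| < s₀`; (ii) `ContDiffOn ℝ 1` on `(−s₀, s₀)`. -/
theorem hasDerivAt_integral_loopDirection_S (hd : 1 ≤ d) (hN : 1 ≤ N) {β b cc v a' Λ' t : ℝ}
    (hc : 0 ≤ cc) (hv : 0 ≤ v) (hb : |β| * (2 * ((d : ℝ) - 1)) ≤ b)
    (hP : ∀ B : Matrix (Fin N) (Fin N) ℂ, matrixOpNorm B ≤ b →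
      ∀ (ψ : Matrix.specialUnitaryGroup (Fin N) ℂ → ℝ) (M : ℝ), 0 ≤ M →
        (∀ x y, |ψ x - ψ y| ≤ M * suFrobDist x y) →
        Var[ψ; (haarProbability (Matrix.specialUnitaryGroup (Fin N) ℂ)).tilted
          fun g => (N : ℝ) * ((g : Matrix (Fin N) (Fin N) ℂ) * B).trace.re] ≤ cc * M ^ 2)
    (hVB : ∀ B : Matrix (Fin N) (Fin N) ℂ, matrixOpNorm B ≤ b → ∀ Δ : Matrix (Fin N) (Fin N) ℂ,
      Var[fun g : Matrix.specialUnitaryGroup (Fin N) ℂ =>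
          (N : ℝ) * ((g : Matrix (Fin N) (Fin N) ℂ) * Δ).trace.re;
        (haarProbability (Matrix.specialUnitaryGroup (Fin N) ℂ)).tilted
          fun g => (N : ℝ) * ((g : Matrix (Fin N) (Fin N) ℂ) * B).trace.re] ≤ v * frobNorm Δ ^ 2)
    (ht : 0 < t) (hρ : 6 * ((d : ℝ) - 1) * |β| * (exp a' * exp t * Real.sqrt (cc * v)) + exp (a' / 2) * Real.sqrt cc * Λ' < 1)
    {a Λ s₀ : ℝ} (hW : MemBallZdS a Λ t W) (hfin : ∀ X, {i | walkEdges (γ i).walk = X}.Finite) (hnorm : LoopNormLE t γ c ε)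
    (hs₀ : 0 < s₀) (ha' : a + s₀ * (2 * ε) ≤ a') (hΛ' : Λ + s₀ * ε ≤ Λ')
    {ν : ℝ → Measure (LGConfig d (Matrix.specialUnitaryGroup (Fin N) ℂ))}
    (hν : ∀ s ∈ Set.Icc (-s₀) s₀, ν s ∈ perturbedGibbsMeasuresS (d := d) (fundamentalRep (Fin N)) (N * β)
      (W + s • loopFamilyAction (d := d) N γ c))
    {F : LGConfig d (Matrix.specialUnitaryGroup (Fin N) ℂ) → ℝ} (hFm : Measurable F) {ΛF : Finset (ZdEdge d)}
    (hFdep : DependsOn F (↑ΛF : Set (ZdEdge d))) {MF : ℝ} (hMF : ∀ σ, |F σ| ≤ MF) {δF : ZdEdge d → ℝ}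
    (hδF : IsLipBound suFrobDist F δF) :
    (∀ s ∈ Set.Ioo (-s₀) s₀, HasDerivAt (fun s => ∫ U, F U ∂(ν s))
        (-(∑' X : Finset (ZdEdge d), cov[F, loopFamilyAction (d := d) N γ c X; ν s])) s) ∧
      ContDiffOn ℝ 1 (fun s => ∫ U, F U ∂(ν s)) (Set.Ioo (-s₀) s₀) := by
  have hV : MemBallZdS (2 * ε) ε t (loopFamilyAction (d := d) N γ c) := memBallZdS_loopFamilyAction hfin hnorm
  have hε : 0 ≤ ε := hnorm.nonneg
  have key := hasDerivAt_and_continuousOn_direction_S hd hN hc hv hb hP hVB ht hρ hW hV (by positivity) hε hs₀ ha' hΛ'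
    (fun X => isLipBound_loopFamilyAction (N := N) (γ := γ) (c := c) X)
    (fun e => (lipLoad_loopFamilyAction (N := N) hfin hnorm ht.le e).1) (fun e => (lipLoad_loopFamilyAction (N := N) hfin hnorm ht.le e).2)
    hν hFm hFdep hMF hδF
  exact ⟨key.1, Summit.Ventures.YMGap.CouplingResponse.contDiffOn_one_of_hasDerivAt key.1 key.2.neg⟩

end Derivative

/-! ### The derivative as a sum over LOOPS: `−Σ_i cov(F, c_i Re tr U_{γ_i}/N)` -/

section PerLoop

variable {W : Potential (ZdEdge d) (Matrix.specialUnitaryGroup (Fin N) ℂ)}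

/-- Bookkeeping: for a finite family of loops `I`, nonnegative `g` summable over links and per-loop loads `Lᵢ ≥ 0` with `Σ'_{i : e ∈ γ_i} Lᵢ ≤ L`
through every link (`L ≥ 0`): `Σ_{i ∈ I} Lᵢ · Σ_{e ∈ γ_i} g e ≤ L · Σ'_e g e`. -/
theorem sum_mul_sum_le_of_loopLoad {I : Finset ι} {g : ZdEdge d → ℝ} (hg0 : ∀ e, 0 ≤ g e) (hgs : Summable g)
    {Li : ι → ℝ} (hLi0 : ∀ i, 0 ≤ Li i) {L : ℝ} (hL0 : 0 ≤ L)
    (hLs : ∀ e, Summable fun i : ι => (if e ∈ walkEdges (γ i).walk then Li i else 0))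
    (hL : ∀ e, ∑' i : ι, (if e ∈ walkEdges (γ i).walk then Li i else 0) ≤ L) :
    ∑ i ∈ I, Li i * ∑ e ∈ walkEdges (γ i).walk, g e ≤ L * ∑' e, g e := by
  classical
  set U : Finset (ZdEdge d) := I.biUnion fun i => walkEdges (γ i).walk with hU
  have hXU : ∀ i ∈ I, walkEdges (γ i).walk ⊆ U := fun i hi e he => Finset.mem_biUnion.2 ⟨i, hi, he⟩
  calc ∑ i ∈ I, Li i * ∑ e ∈ walkEdges (γ i).walk, g e
      = ∑ i ∈ I, ∑ e ∈ U, (if e ∈ walkEdges (γ i).walk then Li i else 0) * g e := by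
        refine sum_congr rfl fun i hi => ?_
        rw [mul_sum, ← sum_subset (hXU i hi) (fun e _ heX => by rw [if_neg heX, zero_mul])]
        exact sum_congr rfl fun e he => by rw [if_pos he]
    _ = ∑ e ∈ U, (∑ i ∈ I, (if e ∈ walkEdges (γ i).walk then Li i else 0)) * g e := by rw [sum_comm]; simp only [sum_mul]
    _ ≤ ∑ e ∈ U, L * g e := sum_le_sum fun e _ => mul_le_mul_of_nonneg_right
        (((hLs e).sum_le_tsum _ (fun i _ => by split_ifs; exacts [hLi0 i, le_rfl])).trans (hL e)) (hg0 e)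
    _ = L * ∑ e ∈ U, g e := by rw [mul_sum]
    _ ≤ L * ∑' e, g e := mul_le_mul_of_nonneg_left (hgs.sum_le_tsum _ (fun e _ => hg0 e)) hL0

/-- **The per-loop susceptibility series converges absolutely, uniformly on the ball**: member `W'` of `Ball(a', Λ', t)` inside the pair door,
ANY DLR state `μ`, bounded local `F` with Frobenius-Lipschitz vector `δ_F`, loop family of norm `‖c‖_t ≤ ε` (finite fibres not needed here):
`i ↦ cov_μ(F, c_i Re tr U_{γ_i}/N)` is summable. -/
theorem summable_cov_loopTerm_S (hd : 1 ≤ d) (hN : 1 ≤ N) {β b cc v a' Λ' t : ℝ}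
    (hc : 0 ≤ cc) (hv : 0 ≤ v) (hb : |β| * (2 * ((d : ℝ) - 1)) ≤ b)
    (hP : ∀ B : Matrix (Fin N) (Fin N) ℂ, matrixOpNorm B ≤ b →
      ∀ (ψ : Matrix.specialUnitaryGroup (Fin N) ℂ → ℝ) (M : ℝ), 0 ≤ M →
        (∀ x y, |ψ x - ψ y| ≤ M * suFrobDist x y) →
        Var[ψ; (haarProbability (Matrix.specialUnitaryGroup (Fin N) ℂ)).tilted
          fun g => (N : ℝ) * ((g : Matrix (Fin N) (Fin N) ℂ) * B).trace.re] ≤ cc * M ^ 2)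
    (hVB : ∀ B : Matrix (Fin N) (Fin N) ℂ, matrixOpNorm B ≤ b → ∀ Δ : Matrix (Fin N) (Fin N) ℂ,
      Var[fun g : Matrix.specialUnitaryGroup (Fin N) ℂ =>
          (N : ℝ) * ((g : Matrix (Fin N) (Fin N) ℂ) * Δ).trace.re;
        (haarProbability (Matrix.specialUnitaryGroup (Fin N) ℂ)).tilted
          fun g => (N : ℝ) * ((g : Matrix (Fin N) (Fin N) ℂ) * B).trace.re] ≤ v * frobNorm Δ ^ 2)
    (ht : 0 < t) (hρ : 6 * ((d : ℝ) - 1) * |β| * (exp a' * exp t * Real.sqrt (cc * v)) + exp (a' / 2) * Real.sqrt cc * Λ' < 1)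
    {W' : Potential (ZdEdge d) (Matrix.specialUnitaryGroup (Fin N) ℂ)} (hW' : MemBallZdS a' Λ' t W')
    (hnorm : LoopNormLE t γ c ε)
    {μ : Measure (LGConfig d (Matrix.specialUnitaryGroup (Fin N) ℂ))}
    (hμ : μ ∈ perturbedGibbsMeasuresS (d := d) (fundamentalRep (Fin N)) (N * β) W')
    {F : LGConfig d (Matrix.specialUnitaryGroup (Fin N) ℂ) → ℝ} (hFm : Measurable F) {ΛF : Finset (ZdEdge d)}
    (hFdep : DependsOn F (↑ΛF : Set (ZdEdge d))) {MF : ℝ} (hMF : ∀ σ, |F σ| ≤ MF) {δF : ZdEdge d → ℝ}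
    (hδF : IsLipBound suFrobDist F δF) :
    Summable fun i : ι => cov[F, loopTerm (d := d) N (c i) (γ i).walk; μ] := by
  classical
  obtain ⟨B', hB'⟩ := hW'.summable
  obtain ⟨osc', lip', ℓ', hosc', hlip', hoscs', hosca', hlips', hℓ', hℓs', hℓt'⟩ := hW'.loads
  set A₀ : ℝ := 2 * (2 * Real.sqrt N) ^ 2 * ∑ y ∈ ΛF, δF y with hA₀
  set g₀ : ZdEdge d → ℝ := fun e => exp (-t * linkSetDist ΛF e) with hg₀
  set Li : ι → ℝ := fun i => ∑ y ∈ walkEdges (γ i).walk, |c i| * (dartMult (γ i).walk y / Real.sqrt N) with hLi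
  have hδ0 : 0 ≤ ∑ y ∈ ΛF, δF y := sum_nonneg fun y _ => hδF.nonneg y
  have hA₀0 : 0 ≤ A₀ := by positivity
  have hLi0 : ∀ i, 0 ≤ Li i := fun i => sum_nonneg fun y _ => by positivity
  have hg0 : ∀ e, 0 ≤ g₀ e := fun e => (exp_pos _).le
  have hεN : 0 ≤ ε / Real.sqrt N := div_nonneg hnorm.nonneg (Real.sqrt_nonneg _)
  have hterm : ∀ i, |cov[F, loopTerm (d := d) N (c i) (γ i).walk; μ]| ≤ A₀ * Li i * ∑ e ∈ walkEdges (γ i).walk, g₀ e := by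
    intro i
    have h1 := abs_cov_le_of_isLipBound_S hd hN hc hv hb hP hVB hB' hW'.continuous hW'.dependsOn hosc' hoscs' hosca' hlip' hlips'
      hℓ' ht.le hℓs' hℓt' hρ hμ hFm hFdep hMF hδF (continuous_loopTerm (c := c i) (γ i).walk).measurable
      (dependsOn_loopTerm (c := c i) (γ i).walk) (abs_loopTerm_le (c := c i) (γ i).walk) (isLipBound_loopTerm (c := c i) (γ i).walk)
    refine le_mul_sum_exp_of_le_mul_exp ht.le hA₀0 (hLi0 i) ?_ (fun hX => ?_) (fun hΔ => ?_)
    · simpa only [hA₀, hLi, mul_assoc, mul_comm, mul_left_comm] using h1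
    · simp only [hLi, Finset.not_nonempty_iff_eq_empty.1 hX, sum_empty]
    · simp only [hA₀, Finset.not_nonempty_iff_eq_empty.1 hΔ, sum_empty, mul_zero]
  have hload := fun e => perLoop_lipLoad (N := N) hnorm ht.le e
  refine Summable.of_abs (summable_of_sum_le (fun i => abs_nonneg _)
    (c := A₀ * (ε / Real.sqrt N * (ΛF.card * (d * ((1 + exp (-(t / d))) / (1 - exp (-(t / d)))) ^ d)))) fun I => ?_)
  have h1 : ∑ i ∈ I, |cov[F, loopTerm (d := d) N (c i) (γ i).walk; μ]| ≤ A₀ * ∑ i ∈ I, Li i * ∑ e ∈ walkEdges (γ i).walk, g₀ e := by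
    rw [mul_sum]; exact sum_le_sum fun i _ => (hterm i).trans (le_of_eq (by ring))
  refine h1.trans ?_
  by_cases hΛF : ΛF.Nonempty
  · obtain ⟨hgs, hgt⟩ := summable_exp_neg_linkSetDist hd ht hΛF
    exact mul_le_mul_of_nonneg_left ((sum_mul_sum_le_of_loopLoad hg0 hgs hLi0 hεN (fun e => (hload e).1)
      (fun e => (hload e).2)).trans (mul_le_mul_of_nonneg_left hgt hεN)) hA₀0
  · have hA00 : A₀ = 0 := by simp only [hA₀, Finset.not_nonempty_iff_eq_empty.1 hΛF, sum_empty, mul_zero]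
    rw [hA00, zero_mul, zero_mul]

end PerLoop

/-! ### `SU(2)`, `ℤ⁴`, hypothesis-free -/

/-- **`SU(2)`, `ℤ⁴` — THE STATE IS `C¹` ALONG EVERY LOOP-COUPLING DIRECTION, uniformly on `MemBallZdS a Λ t`.**  `0 < t`, `0 < s₀`,
`6|β_W| e^{a'} e^{t} + e^{a'/2} √(2/3) Λ' < 1`, `W ∈ MemBallZdS a Λ t`, loop family with finite fibres and `‖c‖_t ≤ ε`, `a + 2s₀ε ≤ a'`, `Λ + s₀ε ≤ Λ'`:
for every selection `ν(s) ∈ 𝒢(W + s·loopFamilyAction 2 γ c)` (bare coupling `β_W/2`) on `|s| ≤ s₀` and every Lipschitz cylinder `F`: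
`d/ds ∫ F dν(s) = −Σ'_X cov_{ν(s)}(F, (loopFamilyAction 2 γ c)_X)` at every `|s| < s₀`, and `ContDiffOn ℝ 1` on `(−s₀, s₀)`. -/
theorem su2_hasDerivAt_integral_loopDirection_dim4 {ι : Type*} {γ : ι → ZdLoop 4} {c : ι → ℝ} {βW a' Λ' t a Λ s₀ ε : ℝ}
    (ht : 0 < t) (hs₀ : 0 < s₀) (hρ : 6 * |βW| * (exp a' * exp t) + exp (a' / 2) * Real.sqrt (2 / 3) * Λ' < 1)
    {W : Potential (ZdEdge 4) (Matrix.specialUnitaryGroup (Fin 2) ℂ)} (hW : MemBallZdS a Λ t W)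
    (hfin : ∀ X, {i | walkEdges (γ i).walk = X}.Finite) (hnorm : LoopNormLE t γ c ε)
    (ha' : a + s₀ * (2 * ε) ≤ a') (hΛ' : Λ + s₀ * ε ≤ Λ')
    {ν : ℝ → Measure (LGConfig 4 (Matrix.specialUnitaryGroup (Fin 2) ℂ))}
    (hν : ∀ s ∈ Set.Icc (-s₀) s₀, ν s ∈ perturbedGibbsMeasuresS (d := 4) (fundamentalRep (Fin 2)) (2 * (βW / 4))
      (W + s • loopFamilyAction (d := 4) 2 γ c))
    {F : LGConfig 4 (Matrix.specialUnitaryGroup (Fin 2) ℂ) → ℝ} {ΛF : Finset (ZdEdge 4)} {KF : ℝ≥0}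
    (hF : IsLipschitzCylinder (fundamentalRep (Fin 2)) F ΛF KF) :
    (∀ s ∈ Set.Ioo (-s₀) s₀, HasDerivAt (fun s => ∫ U, F U ∂(ν s))
        (-(∑' X : Finset (ZdEdge 4), cov[F, loopFamilyAction (d := 4) 2 γ c X; ν s])) s) ∧
      ContDiffOn ℝ 1 (fun s => ∫ U, F U ∂(ν s)) (Set.Ioo (-s₀) s₀) := by
  have hc : (0 : ℝ) ≤ 2 / 3 := by norm_num
  have hP : ∀ B : Matrix (Fin 2) (Fin 2) ℂ, matrixOpNorm B ≤ |βW / 4| * (2 * (((4 : ℕ) : ℝ) - 1)) →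
      ∀ (ψ : Matrix.specialUnitaryGroup (Fin 2) ℂ → ℝ) (M : ℝ), 0 ≤ M →
        (∀ x y, |ψ x - ψ y| ≤ M * suFrobDist x y) →
        Var[ψ; (haarProbability (Matrix.specialUnitaryGroup (Fin 2) ℂ)).tilted
          fun g => ((2 : ℕ) : ℝ) * ((g : Matrix (Fin 2) (Fin 2) ℂ) * B).trace.re] ≤ 2 / 3 * M ^ 2 :=
    fun B hB ψ M hM hψ => oneLinkPoincareSUN_two_sharp _ B hB ψ M hM hψ
  have hVB := linVariance_of_poincare (N := 2) hP
  have hv : (0 : ℝ) ≤ 2 / 3 * ((2 : ℕ) : ℝ) ^ 2 := by norm_num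
  have hsq : Real.sqrt (2 / 3 * (2 / 3 * ((2 : ℕ) : ℝ) ^ 2)) = 4 / 3 := by
    rw [show (2 / 3 * (2 / 3 * ((2 : ℕ) : ℝ) ^ 2) : ℝ) = (4 / 3) ^ 2 by norm_num, Real.sqrt_sq (by norm_num)]
  have hρ' : 6 * (((4 : ℕ) : ℝ) - 1) * |βW / 4| * (exp a' * exp t * Real.sqrt (2 / 3 * (2 / 3 * ((2 : ℕ) : ℝ) ^ 2))) +
      exp (a' / 2) * Real.sqrt (2 / 3) * Λ' < 1 := by
    rw [hsq, abs_div, abs_of_pos (by norm_num : (0 : ℝ) < 4)]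
    have : 6 * (((4 : ℕ) : ℝ) - 1) * (|βW| / 4) * (exp a' * exp t * (4 / 3)) = 6 * |βW| * (exp a' * exp t) := by norm_num; ring
    rw [this]; exact hρ
  have hν' : ∀ s ∈ Set.Icc (-s₀) s₀, ν s ∈ perturbedGibbsMeasuresS (d := 4) (fundamentalRep (Fin 2)) ((2 : ℕ) * (βW / 4))
      (W + s • loopFamilyAction (d := 4) 2 γ c) := fun s hs => by simpa using hν s hs
  have hA : ∀ a b : Matrix.specialUnitaryGroup (Fin 2) ℂ, dist (suEntries a) (suEntries b) ≤ 1 * suFrobDist a b :=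
    fun a b => by rw [one_mul]; exact dist_suEntries_le_suFrobDist a b
  exact hasDerivAt_integral_loopDirection_S (N := 2) (d := 4) (by norm_num) (by norm_num) hc hv le_rfl hP hVB ht hρ' hW hfin hnorm hs₀ ha' hΛ'
    hν' hF.measurable hF.dependsOn hF.abs_le (hF.isLipBound zero_le_one hA)

/-- **THE `SU(2)` WILSON POINT ON `ℤ⁴`: SWITCHING ON ANY FAMILY OF WILSON-LOOP COUPLINGS OF FINITE NORM, THE STATE RESPONDS `C¹`.**  `0 < t`,
`0 < s₀`, loop family with finite fibres and `‖c‖_t ≤ ε`, `6|β_W| e^{2s₀ε} e^{t} + e^{s₀ε} √(2/3) s₀ε < 1`: for every selection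
`ν(s) ∈ 𝒢(Wilson + s·loopFamilyAction 2 γ c)`, `|s| ≤ s₀`, every Lipschitz cylinder `F`:
`d/ds ∫ F dν(s) = −Σ'_X cov_{ν(s)}(F, (loopFamilyAction 2 γ c)_X)` at every `|s| < s₀` (in particular AT the Wilson point) and `ContDiffOn ℝ 1`. -/
theorem su2_wilson_hasDerivAt_integral_loopDirection {ι : Type*} {γ : ι → ZdLoop 4} {c : ι → ℝ} {βW t s₀ ε : ℝ}
    (ht : 0 < t) (hs₀ : 0 < s₀)
    (hρ : 6 * |βW| * (exp (s₀ * (2 * ε)) * exp t) + exp (s₀ * (2 * ε) / 2) * Real.sqrt (2 / 3) * (s₀ * ε) < 1)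
    (hfin : ∀ X, {i | walkEdges (γ i).walk = X}.Finite) (hnorm : LoopNormLE t γ c ε)
    {ν : ℝ → Measure (LGConfig 4 (Matrix.specialUnitaryGroup (Fin 2) ℂ))}
    (hν : ∀ s ∈ Set.Icc (-s₀) s₀, ν s ∈ perturbedGibbsMeasuresS (d := 4) (fundamentalRep (Fin 2)) (2 * (βW / 4))
      (0 + s • loopFamilyAction (d := 4) 2 γ c))
    {F : LGConfig 4 (Matrix.specialUnitaryGroup (Fin 2) ℂ) → ℝ} {ΛF : Finset (ZdEdge 4)} {KF : ℝ≥0}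
    (hF : IsLipschitzCylinder (fundamentalRep (Fin 2)) F ΛF KF) :
    (∀ s ∈ Set.Ioo (-s₀) s₀, HasDerivAt (fun s => ∫ U, F U ∂(ν s))
        (-(∑' X : Finset (ZdEdge 4), cov[F, loopFamilyAction (d := 4) 2 γ c X; ν s])) s) ∧
      ContDiffOn ℝ 1 (fun s => ∫ U, F U ∂(ν s)) (Set.Ioo (-s₀) s₀) :=
  su2_hasDerivAt_integral_loopDirection_dim4 (a := 0) (Λ := 0) ht hs₀ hρ (memBallZdS_zero le_rfl le_rfl) hfin hnorm
    (by simp) (by simp) hν hF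

end Summit.Ventures.YMGap.RobustBall

end
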